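import Summits.Ventures.HSemireg.WedgeHankelGlue

/-!
# Venture HSemireg — THE SIEGEL KERNEL: for EVERY class `v ∈ K[Θ]` on an `m`-fold the symmetric 2-vectors `x_a ∧ y_b + x_b ∧ y_a`, `x_a ∧ y_a`
# lie in `ker(θ ↦ θ ∧ w_m(q) ∣ ⋀²)` — a NAMED, `q`-INDEPENDENT kernel of dimension `m(m+1)/2` (th-6's «Θ-isotropic part / Siegel space S²_Θ»)

HONEST FRAMING. Part of the Lean index of the computation cell `pub-hsemireg` (seat p10 gen 10, Sunday typer «UNIFORM-IN-n»).
Finite-dimensional EXTERIOR ALGEBRA over a field ONLY: no variety, no cohomology theory, no sheaf, no Ext group and no semiregularity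
map is constructed here; nothing here says that HC / HC_CM / HC_AV holds; no Literature fact is declared or used.  Custodian versions
cited: theory/FORMULA-N.md PART A §2.6 THEOREM H and FN-4 (i) («with v-independent kernel the Θ-isotropic part (on HT²: the Siegel space
S²_Θ)»), PART B §N.8 (th-7's recursion `w₀(q) = q₀·1`, `w_{j+1}(q) = w_j(q)·x_j + w_j(σq)·y_j`); STRUCTURE.md v1.0-SIGNED 9b196a05977dd067 §1.1
C15.  The dictionary (`v = Σ_j q_j Θ^j/j!` ↦ `w_m(q)`; `x_a ↔ ∂_a`, `y_a ↔ dz̄_a`; `⌟v` on `HT²` ↦ `θ ↦ θ ∧ w_m(q)` on `⋀² K^{2m}`) is QUOTED,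
never asserted.

WHAT IS IN THE TREE.  THEOREM H (`WedgeHankelModel.hankelLaw_model`) gives every RANK; p10 g10's `WedgeHankelSpikes` the CEILING and a numeric kernel
FLOOR `C(2m,2) − 3C(m,2) = m(m+1)/2` on `⋀²`.  NOT in the tree: the NAME of that kernel.  THIS FILE (PLAIN: imports the built tree file `WedgeHankelGlue`
only; everything from th-7's recursion and generator anticommutation — NO permutation sign is evaluated):
* §1 generator bookkeeping in th-7's model (`X_c`, `Y_c` are generators or `0`; squares vanish; any two anticommute).
* §2 **THE OLD-PAIR LEMMA `w_mul_X_add`: `w_j(q)·x_a + w_j(σq)·y_a = 0` for every `a < j` and every `q`** (the recursion step re-applied to a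
  pair already used gives zero; induction on `j` from the top, sign-free), hence `w_j(q)·x_a·y_a = 0` (`w_mul_X_mul_Y`).
* §3 **THE SYMMETRIC-PAIR LEMMA `w_mul_sym`: `w_j(q)·(x_a y_b + x_b y_a) = 0` for all `a < b < j`, every `q`** (base `j = b+1` from §2,
  induction step because `x_j`, `y_j` commute with the even element `x_a y_b + x_b y_a`).
* §4 **THE SIEGEL KERNEL THEOREM**: the symmetric 2-vectors `s_{ab} := x_a y_b + x_b y_a` (`a < b < m`) and `s_{aa} := x_a y_a` lie in `⋀²` and
  **`sym_mul_w`, `diag_mul_w`: `s_{ab} ∧ w_m(q) = 0` for EVERY `q`** (left form via graded commutation `B_mul_comm_of_mem_Hom`: even past homogeneous);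
  **`siegel_le_ker`: `Siegel_m := span{s_{ab} : a ≤ b} ≤ ker(θ ↦ θ ∧ w_m(q) ∣ ⋀²)` for every field, `m`, `q`**; the `s_{ab}` are LINEARLY
  INDEPENDENT (`linearIndependent_sgen`, disjoint leading monomials), **`finrank_siegel`: `dim Siegel_m = m(m+1)/2`** (in the form `2·dim = m(m+1)`),
  hence **`finrank_ker_wedge_two_ge`: `dim ker(θ ↦ θ ∧ w_m(q) ∣ ⋀²) ≥ m(m+1)/2` for EVERY class — a named floor, equal to `WedgeHankelSpikes`'
  numeric floor `C(2m,2) − 3C(m,2)`**; and **`ker_eq_siegel_of_finrank`: whenever the degree-2 rank is the generic `3·C(m,2)` (e.g. the middle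
  power `Θ^{⌊m/2⌋}`, `WedgeHankelSpikes.finrank_range_wedge_w_spike_middle_two`, `m ≥ 4`) the kernel IS the Siegel space, nothing more.**
In the quoted dictionary: `s_{ab} ↔ ∂_a ∧ dz̄_b + ∂_b ∧ dz̄_a`, the SYMMETRIC piece of `H¹(T)` — th-6's «Siegel space S²_Θ» (deformations of `(X, Θ)` as a
polarised variety): they contract EVERY polynomial in `Θ` to zero on `HT²`, for every `m`, field and `q`.  NOT typed: higher degrees (the ideal generated
by `Siegel_m`); the excess kernel when the degree-2 Hankel rank is `< 3` (the pairs' kernels of the lineage); anything Ext-side.  Class side only.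
Namespace `Summit.Ventures.HSemireg.Wedge.HankelSiegel` (new); new names only.
-/

open Module

namespace Summit.Ventures.HSemireg.Wedge.HankelSiegel

open Summit.Ventures.HSemireg.Wedge Summit.Ventures.HSemireg.Wedge.Hankel

variable (K : Type*) [Field K] {n : ℕ}

/-! ## §1. Generators in th-7's model: squares vanish, any two anticommute -/

/-- `X_c` is a generator or zero (junk `0` beyond `n`). -/
lemma X_gen (c : ℕ) : X K n c = 0 ∨ ∃ i : In n, X K n c = gx K i := by
  unfold X
  split_ifs with h
  · exact Or.inr ⟨_, rfl⟩
  · exact Or.inl rfl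

/-- `Y_c` is a generator or zero. -/
lemma Y_gen (c : ℕ) : Y K n c = 0 ∨ ∃ i : In n, Y K n c = gx K i := by
  unfold Y
  split_ifs with h
  · exact Or.inr ⟨_, rfl⟩
  · exact Or.inl rfl

variable {K}

/-- generators (or zero) square to zero. -/
lemma mul_self_of_gen {u : HT K (In n)} (hu : u = 0 ∨ ∃ i : In n, u = gx K i) : u * u = 0 := by
  rcases hu with rfl | ⟨i, rfl⟩
  · rw [mul_zero]
  · exact gx_mul_self K i

/-- generators (or zero) anticommute. -/
lemma anticomm_of_gen {u v : HT K (In n)} (hu : u = 0 ∨ ∃ i : In n, u = gx K i) (hv : v = 0 ∨ ∃ i : In n, v = gx K i) :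
    u * v = -(v * u) := by
  rcases hu with rfl | ⟨i, rfl⟩
  · rw [zero_mul, mul_zero, neg_zero]
  · rcases hv with rfl | ⟨j, rfl⟩
    · rw [zero_mul, mul_zero, neg_zero]
    · exact gy_mul_gx K j i

/-- `u v u = 0` for generators (or zero). -/
lemma mul_mul_self_of_gen {u v : HT K (In n)} (hu : u = 0 ∨ ∃ i : In n, u = gx K i) (hv : v = 0 ∨ ∃ i : In n, v = gx K i) :
    u * v * u = 0 := by
  rw [anticomm_of_gen hu hv, neg_mul, mul_assoc, mul_self_of_gen hu, mul_zero, neg_zero]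

/-- a generator commutes with a product of two generators (two sign flips). -/
lemma comm_pair_of_gen {u v t : HT K (In n)} (hu : u = 0 ∨ ∃ i : In n, u = gx K i) (hv : v = 0 ∨ ∃ i : In n, v = gx K i)
    (ht : t = 0 ∨ ∃ i : In n, t = gx K i) : t * (u * v) = u * v * t := by
  rw [← mul_assoc, anticomm_of_gen ht hu, neg_mul, mul_assoc, anticomm_of_gen ht hv, mul_neg, neg_neg, mul_assoc]

variable (K)

/-! ## §2. The old-pair lemma: `w_j(q)·x_a + w_j(σq)·y_a = 0` for `a < j` -/

/-- one step of th-7's recursion (definitional). -/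
lemma w_succ (j : ℕ) (q : ℕ → K) : w K n (j + 1) q = w K n j q * X K n j + w K n j (shift K q) * Y K n j := rfl

/-- the old-pair lemma at distance `d`: `j = a + 1 + d`. -/
lemma w_mul_X_add_aux (a d : ℕ) (q : ℕ → K) :
    w K n (a + 1 + d) q * X K n a + w K n (a + 1 + d) (shift K q) * Y K n a = 0 := by
  induction d generalizing q with
  | zero =>
    rw [add_zero, w_succ, w_succ]
    have h1 := mul_self_of_gen (X_gen K (n := n) a)
    have h2 := mul_self_of_gen (Y_gen K (n := n) a)
    have h3 := anticomm_of_gen (Y_gen K (n := n) a) (X_gen K (n := n) a)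
    calc (w K n a q * X K n a + w K n a (shift K q) * Y K n a) * X K n a +
          (w K n a (shift K q) * X K n a + w K n a (shift K (shift K q)) * Y K n a) * Y K n a
        = w K n a q * (X K n a * X K n a) + w K n a (shift K (shift K q)) * (Y K n a * Y K n a) +
            w K n a (shift K q) * (Y K n a * X K n a + X K n a * Y K n a) := by noncomm_ring
      _ = 0 := by rw [h1, h2, h3, neg_add_cancel, mul_zero, mul_zero, mul_zero, add_zero, add_zero]
  | succ d ih =>
    rw [show a + 1 + (d + 1) = (a + 1 + d) + 1 by omega, w_succ, w_succ]
    set j := a + 1 + d with hj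
    have h1 := anticomm_of_gen (X_gen K (n := n) j) (X_gen K (n := n) a)
    have h2 := anticomm_of_gen (Y_gen K (n := n) j) (X_gen K (n := n) a)
    have h3 := anticomm_of_gen (X_gen K (n := n) j) (Y_gen K (n := n) a)
    have h4 := anticomm_of_gen (Y_gen K (n := n) j) (Y_gen K (n := n) a)
    calc (w K n j q * X K n j + w K n j (shift K q) * Y K n j) * X K n a +
          (w K n j (shift K q) * X K n j + w K n j (shift K (shift K q)) * Y K n j) * Y K n a
        = w K n j q * (X K n j * X K n a) + w K n j (shift K q) * (Y K n j * X K n a) +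
            w K n j (shift K q) * (X K n j * Y K n a) + w K n j (shift K (shift K q)) * (Y K n j * Y K n a) := by
          noncomm_ring
      _ = -((w K n j q * X K n a + w K n j (shift K q) * Y K n a) * X K n j) -
            ((w K n j (shift K q) * X K n a + w K n j (shift K (shift K q)) * Y K n a) * Y K n j) := by
          rw [h1, h2, h3, h4]; noncomm_ring
      _ = 0 := by rw [ih q, ih (shift K q), zero_mul, zero_mul, neg_zero, sub_zero]

/-- **THE OLD-PAIR LEMMA**: re-applying the recursion step to a pair `a` already used gives zero —
`w_j(q)·x_a + w_j(σq)·y_a = 0` for every `a < j` and every sequence `q` (induction on `j`; only `x² = y² = 0` and anticommutation). -/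
theorem w_mul_X_add {a j : ℕ} (haj : a < j) (q : ℕ → K) :
    w K n j q * X K n a + w K n j (shift K q) * Y K n a = 0 := by
  obtain ⟨d, rfl⟩ : ∃ d, j = a + 1 + d := ⟨j - (a + 1), by omega⟩
  exact w_mul_X_add_aux K a d q

/-- hence **`w_j(q)·x_a·y_a = 0`** for `a < j`, every `q` (the diagonal symmetric 2-vector is killed on the right). -/
theorem w_mul_X_mul_Y {a j : ℕ} (haj : a < j) (q : ℕ → K) : w K n j q * X K n a * Y K n a = 0 := by
  have h := w_mul_X_add K (n := n) haj q
  rw [add_eq_zero_iff_eq_neg] at h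
  rw [h, neg_mul, mul_assoc, mul_self_of_gen (Y_gen K (n := n) a), mul_zero, neg_zero]

/-! ## §3. The symmetric-pair lemma: `w_j(q)·(x_a y_b + x_b y_a) = 0` for `a < b < j` -/

/-- the symmetric-pair lemma at distance `d`: `j = b + 1 + d`. -/
lemma w_mul_sym_aux {a b : ℕ} (hab : a < b) (d : ℕ) (q : ℕ → K) :
    w K n (b + 1 + d) q * (X K n a * Y K n b + X K n b * Y K n a) = 0 := by
  induction d generalizing q with
  | zero =>
    rw [add_zero, w_succ]
    have h1 := mul_self_of_gen (X_gen K (n := n) b)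
    have h2 := mul_mul_self_of_gen (Y_gen K (n := n) b) (X_gen K (n := n) a)
    have h3 := anticomm_of_gen (X_gen K (n := n) b) (X_gen K (n := n) a)
    have f1 := anticomm_of_gen (Y_gen K (n := n) b) (X_gen K (n := n) b)
    have f2 := anticomm_of_gen (Y_gen K (n := n) b) (Y_gen K (n := n) a)
    have f3 := anticomm_of_gen (X_gen K (n := n) b) (Y_gen K (n := n) a)
    have h4 : Y K n b * X K n b * Y K n a = -(Y K n a * (X K n b * Y K n b)) := by
      calc Y K n b * X K n b * Y K n a = -(X K n b * (Y K n b * Y K n a)) := by rw [f1, neg_mul, mul_assoc]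
        _ = X K n b * Y K n a * Y K n b := by rw [f2, mul_neg, neg_neg, mul_assoc]
        _ = -(Y K n a * (X K n b * Y K n b)) := by rw [f3, neg_mul, mul_assoc]
    have hL := w_mul_X_add K (n := n) hab q
    calc (w K n b q * X K n b + w K n b (shift K q) * Y K n b) * (X K n a * Y K n b + X K n b * Y K n a)
        = w K n b q * (X K n b * X K n a) * Y K n b + w K n b q * (X K n b * X K n b) * Y K n a +
            w K n b (shift K q) * (Y K n b * X K n a * Y K n b) + w K n b (shift K q) * (Y K n b * X K n b * Y K n a) := by
          noncomm_ring
      _ = -((w K n b q * X K n a + w K n b (shift K q) * Y K n a) * (X K n b * Y K n b)) := by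
          rw [h1, h2, h3, h4]; noncomm_ring
      _ = 0 := by rw [hL, zero_mul, neg_zero]
  | succ d ih =>
    rw [show b + 1 + (d + 1) = (b + 1 + d) + 1 by omega, w_succ]
    set j := b + 1 + d with hj
    have hc1 : X K n j * (X K n a * Y K n b + X K n b * Y K n a) = (X K n a * Y K n b + X K n b * Y K n a) * X K n j := by
      rw [mul_add, add_mul, comm_pair_of_gen (X_gen K a) (Y_gen K b) (X_gen K j),
        comm_pair_of_gen (X_gen K b) (Y_gen K a) (X_gen K j)]
    have hc2 : Y K n j * (X K n a * Y K n b + X K n b * Y K n a) = (X K n a * Y K n b + X K n b * Y K n a) * Y K n j := by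
      rw [mul_add, add_mul, comm_pair_of_gen (X_gen K a) (Y_gen K b) (Y_gen K j),
        comm_pair_of_gen (X_gen K b) (Y_gen K a) (Y_gen K j)]
    rw [add_mul, mul_assoc, hc1, mul_assoc, hc2, ← mul_assoc, ← mul_assoc, ih q, ih (shift K q), zero_mul, zero_mul, add_zero]

/-- **THE SYMMETRIC-PAIR LEMMA**: `w_j(q)·(x_a·y_b + x_b·y_a) = 0` for all `a < b < j` and every `q`. -/
theorem w_mul_sym {a b j : ℕ} (hab : a < b) (hbj : b < j) (q : ℕ → K) :
    w K n j q * (X K n a * Y K n b + X K n b * Y K n a) = 0 := by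
  obtain ⟨d, rfl⟩ : ∃ d, j = b + 1 + d := ⟨j - (b + 1), by omega⟩
  exact w_mul_sym_aux K hab d q

/-! ## §4. The Siegel kernel theorem -/

/-- the SYMMETRIC 2-VECTOR of the pair `(a, b)`: `s_{ab} := x_a·y_b + x_b·y_a` for `a ≠ b` and `s_{aa} := x_a·y_a`
(dictionary: `∂_a ∧ dz̄_b + ∂_b ∧ dz̄_a`, th-6's Siegel / Θ-isotropic directions on `HT²`). -/
noncomputable def sv (a b : ℕ) : HT K (In n) := X K n a * Y K n b + if a = b then 0 else X K n b * Y K n a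

/-- th-7's Hankel class on all `2n` generators is homogeneous of degree `n`. -/
lemma w_top_mem_Hom (q : ℕ → K) : w K n n q ∈ Hom K (In n) Finset.univ n := by
  have h := w_mem_Hom K (n := n) le_rfl q
  rwa [Dm_top] at h

/-- **the Hankel class kills every symmetric 2-vector on the RIGHT: `w_n(q) · s_{ab} = 0`** (`a, b < n`, every `q`). -/
theorem w_mul_sv {a b : ℕ} (ha : a < n) (hb : b < n) (q : ℕ → K) : w K n n q * sv K a b = 0 := by
  unfold sv
  rcases Nat.lt_trichotomy a b with hab | rfl | hba
  · rw [if_neg (Nat.ne_of_lt hab)]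
    exact w_mul_sym K hab hb q
  · rw [if_pos rfl, add_zero, ← mul_assoc]
    exact w_mul_X_mul_Y K ha q
  · rw [if_neg (Nat.ne_of_gt hba), add_comm]
    exact w_mul_sym K hba ha q

/-- an element of `Hom D 2` (an even 2-form) commutes with every homogeneous element. -/
lemma mul_comm_of_mem_Hom_two {D D' : Finset (In n)} {d : ℕ} {θ f : HT K (In n)} (hθ : θ ∈ Hom K (In n) D 2)
    (hf : f ∈ Hom K (In n) D' d) : θ * f = f * θ := by
  induction hθ using Submodule.span_induction with
  | mem x hx =>
    obtain ⟨t, ht, rfl⟩ := hx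
    rw [B_mul_comm_of_mem_Hom K hf t, ht.2, show (-1 : K) ^ (2 * d) = 1 by rw [pow_mul, neg_one_sq, one_pow], one_smul]
  | zero => rw [zero_mul, mul_zero]
  | add x y _ _ hx hy => rw [add_mul, mul_add, hx, hy]
  | smul c x _ hx => rw [smul_mul_assoc, mul_smul_comm, hx]

/-- a product of two distinct generators is homogeneous of degree `2`. -/
lemma gx_mul_gx_mem_Hom_two {i j : In n} (hij : i ≠ j) : gx K i * gx K j ∈ Hom K (In n) Finset.univ 2 := by
  rw [gx_mul_gy]
  exact Submodule.smul_mem _ _ (B_mem_Hom K (Finset.subset_univ _) (Finset.card_pair hij))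

/-- `x_a · y_b` is homogeneous of degree `2` (or zero). -/
lemma X_mul_Y_mem_Hom_two (a b : ℕ) : X K n a * Y K n b ∈ Hom K (In n) Finset.univ 2 := by
  unfold X Y
  split_ifs with ha hb
  · exact gx_mul_gx_mem_Hom_two K (fun h => by have := congrArg Fin.val h; simp [xI, yI] at this; omega)
  all_goals simp

/-- the symmetric 2-vectors are homogeneous of degree `2`. -/
lemma sv_mem_Hom_two (a b : ℕ) : sv K a b ∈ Hom K (In n) Finset.univ 2 := by
  unfold sv
  split_ifs
  · rw [add_zero]; exact X_mul_Y_mem_Hom_two K a b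
  · exact Submodule.add_mem _ (X_mul_Y_mem_Hom_two K a b) (X_mul_Y_mem_Hom_two K b a)

/-- the symmetric 2-vectors lie in `⋀²`. -/
lemma sv_mem_exteriorPower (a b : ℕ) : sv K a b ∈ ⋀[K]^2 (In n → K) := by
  rw [exteriorPower_eq_Hom_univ]
  exact sv_mem_Hom_two K a b

/-- **THE SIEGEL KERNEL, element form: `s_{ab} ∧ w_n(q) = 0`** for all `a, b < n` and EVERY sequence `q`
(left form = the form `θ ↦ θ ∧ w_n(q)` uses; from `w_mul_sv` by even/homogeneous commutation). -/
theorem sv_mul_w {a b : ℕ} (ha : a < n) (hb : b < n) (q : ℕ → K) : sv K a b * w K n n q = 0 := by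
  rw [mul_comm_of_mem_Hom_two K (sv_mem_Hom_two K a b) (w_top_mem_Hom K q)]
  exact w_mul_sv K ha hb q

/-- index set of the symmetric 2-vectors: pairs `a ≤ b < n`, as `Σ b : Fin n, Fin (b+1)`. -/
abbrev SIdx (n : ℕ) : Type := Σ b : Fin n, Fin ((b : ℕ) + 1)

/-- the family of symmetric 2-vectors `s_{ab}`, `a ≤ b < n`. -/
noncomputable def sgen (p : SIdx n) : HT K (In n) := sv K (p.2 : ℕ) (p.1 : ℕ)

/-- **THE SIEGEL SPACE** `Siegel_n := span{s_{ab} : a ≤ b < n} ⊆ ⋀² K^{2n}`. -/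
noncomputable def siegel (n : ℕ) : Submodule K (HT K (In n)) := Submodule.span K (Set.range (sgen K (n := n)))

/-- the Siegel space lies in `⋀²`. -/
lemma siegel_le_exteriorPower : siegel K n ≤ ⋀[K]^2 (In n → K) := by
  rw [siegel, Submodule.span_le]
  rintro _ ⟨p, rfl⟩
  exact sv_mem_exteriorPower K _ _

/-- **every element of the Siegel space is killed: `θ ∧ w_n(q) = 0` for `θ ∈ Siegel_n`, EVERY `q`.** -/
theorem mul_w_eq_zero_of_mem_siegel {θ : HT K (In n)} (hθ : θ ∈ siegel K n) (q : ℕ → K) : θ * w K n n q = 0 := by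
  induction hθ using Submodule.span_induction with
  | mem x hx =>
    obtain ⟨⟨b, a⟩, rfl⟩ := hx
    exact sv_mul_w K (by have := a.2; omega) b.2 q
  | zero => rw [zero_mul]
  | add x y _ _ hx hy => rw [add_mul, hx, hy, add_zero]
  | smul c x _ hx => rw [smul_mul_assoc, hx, smul_zero]

/-- in EVERY degree: the left ideal generated by the Siegel space is killed — `(η ∧ θ) ∧ w_n(q) = 0` for `θ ∈ Siegel_n` and any `η`
(so `⋀^{k−2} ∧ Siegel_n ⊆ ker` on `⋀^k`; since `Siegel_n` is even this is also the two-sided ideal; its dimension in degree `k` is not computed here). -/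
theorem mul_mul_w_eq_zero_of_mem_siegel {θ : HT K (In n)} (hθ : θ ∈ siegel K n) (η : HT K (In n)) (q : ℕ → K) :
    η * θ * w K n n q = 0 := by
  rw [mul_assoc, mul_w_eq_zero_of_mem_siegel K hθ q, mul_zero]

/-- **THE SIEGEL KERNEL THEOREM: `Siegel_n ≤ ker(θ ↦ θ ∧ w_n(q) ∣ ⋀²)` for every field, every `n`, every `q`**
(the Siegel space viewed inside `⋀²` along its inclusion). -/
theorem siegel_le_ker (q : ℕ → K) :
    (siegel K n).comap (⋀[K]^2 (In n → K)).subtype ≤ LinearMap.ker (Hankel.wedge K n 2 (w K n n q)) := by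
  intro θ hθ
  rw [LinearMap.mem_ker, Hankel.wedge, LinearMap.comp_apply, Submodule.subtype_apply, LinearMap.mulRight_apply]
  exact mul_w_eq_zero_of_mem_siegel K hθ q

/-! ### linear independence and the count `n(n+1)/2` -/

/-- the `x`- and `y`-indices never coincide. -/
lemma xI_ne_yI' {a b : ℕ} (ha : a < n) (hb : b < n) : xI (n := n) a ha ≠ yI b hb := by
  intro h
  have := congrArg Fin.val h
  simp [xI, yI] at this
  omega

/-- the coordinate of `x_{a'}·y_{b'}` at the monomial `{x_a, y_b}`: the sign `u` if `(a', b') = (a, b)`, else `0`. -/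
lemma coord_X_mul_Y {a b a' b' : ℕ} (ha : a < n) (hb : b < n) (ha' : a' < n) (hb' : b' < n) :
    (B K (In n)).coord {xI a ha, yI b hb} (X K n a' * Y K n b') =
      if a' = a ∧ b' = b then u K {xI a ha} {yI b hb} else 0 := by
  rw [X, Y, dif_pos ha', dif_pos hb', gx_mul_gy, map_smul, Basis.coord_apply, Basis.repr_self, Finsupp.single_apply,
    smul_eq_mul]
  by_cases h : a' = a ∧ b' = b
  · obtain ⟨rfl, rfl⟩ := h
    rw [if_pos rfl, if_pos ⟨rfl, rfl⟩, mul_one]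
  · rw [if_neg h, if_neg, mul_zero]
    intro heq
    apply h
    have hx : xI (n := n) a' ha' ∈ ({xI a ha, yI b hb} : Finset (In n)) := by rw [← heq]; simp
    have hy : yI (n := n) b' hb' ∈ ({xI a ha, yI b hb} : Finset (In n)) := by rw [← heq]; simp
    rw [Finset.mem_insert, Finset.mem_singleton] at hx hy
    rcases hx with hx | hx
    · rcases hy with hy | hy
      · exact absurd hy.symm (xI_ne_yI' ha hb')
      · exact ⟨by simpa [xI] using congrArg Fin.val hx, by simpa [yI] using congrArg Fin.val hy⟩
    · exact absurd hx (xI_ne_yI' ha' hb)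

/-- the coordinate of `s_{a'b'}` (`a' ≤ b'`) at the monomial `{x_a, y_b}` (`a ≤ b`): non-zero iff `(a', b') = (a, b)`. -/
lemma coord_sv {a b a' b' : ℕ} (ha : a < n) (hb : b < n) (ha' : a' < n) (hb' : b' < n) (hab : a ≤ b) (hab' : a' ≤ b') :
    (B K (In n)).coord {xI a ha, yI b hb} (sv K a' b') = if a' = a ∧ b' = b then u K {xI a ha} {yI b hb} else 0 := by
  unfold sv
  split_ifs with h1 h2 h2
  · rw [add_zero, coord_X_mul_Y K ha hb ha' hb', if_pos h2]
  · rw [add_zero, coord_X_mul_Y K ha hb ha' hb', if_neg h2]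
  · rw [map_add, coord_X_mul_Y K ha hb ha' hb', coord_X_mul_Y K ha hb hb' ha', if_pos h2, if_neg, add_zero]
    rintro ⟨rfl, rfl⟩
    omega
  · rw [map_add, coord_X_mul_Y K ha hb ha' hb', coord_X_mul_Y K ha hb hb' ha', if_neg h2, if_neg, add_zero]
    rintro ⟨rfl, rfl⟩
    omega

/-- **the symmetric 2-vectors `s_{ab}` (`a ≤ b < n`) are LINEARLY INDEPENDENT** (disjoint leading monomials `{x_a, y_b}`). -/
theorem linearIndependent_sgen : LinearIndependent K (sgen K (n := n)) := by
  classical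
  rw [linearIndependent_iff']
  intro s g hsum p hp
  obtain ⟨b, a⟩ := p
  have ha : (a : ℕ) < n := by have := a.2; omega
  set φ := (B K (In n)).coord {xI (a : ℕ) ha, yI (b : ℕ) b.2} with hφ
  have h := congrArg φ hsum
  rw [map_sum, map_zero] at h
  simp_rw [map_smul] at h
  rw [Finset.sum_eq_single ⟨b, a⟩] at h
  · rw [hφ, sgen, coord_sv K ha b.2 ha b.2 (by have := a.2; omega) (by have := a.2; omega), if_pos ⟨rfl, rfl⟩,
      smul_eq_mul, mul_eq_zero] at h
    exact h.resolve_right ((u_ne_zero_iff K).mpr (Finset.disjoint_singleton.mpr (xI_ne_yI' ha b.2)))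
  · rintro ⟨b', a'⟩ _ hne
    have ha' : (a' : ℕ) < n := by have := a'.2; omega
    rw [hφ, sgen, coord_sv K ha b.2 ha' b'.2 (by have := a.2; omega) (by have := a'.2; omega), if_neg, smul_zero]
    rintro ⟨h1, h2⟩
    apply hne
    have hb' : b' = b := Fin.ext h2
    subst hb'
    have : a' = a := Fin.ext h1
    subst this
    rfl
  · intro hp'
    exact absurd hp hp'

/-- the number of pairs `a ≤ b < n`, doubled: `2 · #SIdx = n(n+1)`. -/
lemma two_mul_card_SIdx : 2 * Fintype.card (SIdx n) = n * (n + 1) := by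
  rw [Fintype.card_sigma]
  simp only [Fintype.card_fin]
  rw [Fin.sum_univ_eq_sum_range (fun b => b + 1) n]
  induction n with
  | zero => simp
  | succ k ih => rw [Finset.sum_range_succ, mul_add, ih]; ring

/-- **`dim Siegel_n = #{a ≤ b < n}`, i.e. `2 · dim Siegel_n = n(n+1)`** (`dim = n(n+1)/2`). -/
theorem two_mul_finrank_siegel : 2 * finrank K (siegel K n) = n * (n + 1) := by
  rw [siegel, finrank_span_eq_card (linearIndependent_sgen K), two_mul_card_SIdx]

/-- **A NAMED KERNEL FLOOR FOR EVERY CLASS: `dim ker(θ ↦ θ ∧ w_n(q) ∣ ⋀²) ≥ dim Siegel_n = n(n+1)/2`** (every field, `n`, `q`). -/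
theorem finrank_siegel_le_finrank_ker (q : ℕ → K) :
    finrank K (siegel K n) ≤ finrank K (LinearMap.ker (Hankel.wedge K n 2 (w K n n q))) := by
  rw [← (Submodule.comapSubtypeEquivOfLe (siegel_le_exteriorPower K (n := n))).finrank_eq]
  exact Submodule.finrank_mono (siegel_le_ker K q)

/-- `dim ⋀² K^{2n} = C(2n, 2)`. -/
lemma finrank_exteriorPower_two : finrank K (⋀[K]^2 (In n → K)) = (n + n).choose 2 := by
  rw [exteriorPower.finrank_eq, finrank_fintype_fun_eq_card, Fintype.card_fin]

/-- binomial bookkeeping: `2·C(2n,2) = 6·C(n,2) + n(n+1)`. -/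
lemma two_mul_choose_two_eq : 2 * (n + n).choose 2 = 2 * (3 * n.choose 2) + n * (n + 1) := by
  have h : ((2 * (n + n).choose 2 : ℕ) : ℚ) = ((2 * (3 * n.choose 2) + n * (n + 1) : ℕ) : ℚ) := by
    push_cast [Nat.cast_choose_two]
    ring
  exact_mod_cast h

/-- **WHEN THE DEGREE-2 RANK IS THE GENERIC `3·C(n,2)`, THE KERNEL IS EXACTLY THE SIEGEL SPACE** (every field, every `n`; e.g. the middle
power `Θ^{⌊n/2⌋}`, `n ≥ 4` — `WedgeHankelSpikes.finrank_range_wedge_w_spike_middle_two`): `ker(θ ↦ θ ∧ w_n(q) ∣ ⋀²) = Siegel_n`. -/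
theorem ker_eq_siegel_of_finrank (q : ℕ → K)
    (h : finrank K (LinearMap.range (Hankel.wedge K n 2 (w K n n q))) = 3 * n.choose 2) :
    LinearMap.ker (Hankel.wedge K n 2 (w K n n q)) = (siegel K n).comap (⋀[K]^2 (In n → K)).subtype := by
  symm
  apply Submodule.eq_of_le_of_finrank_eq (siegel_le_ker K q)
  have hrn := LinearMap.finrank_range_add_finrank_ker (Hankel.wedge K n 2 (w K n n q))
  rw [finrank_exteriorPower_two, h] at hrn
  have hs := two_mul_finrank_siegel K (n := n)
  have hc := two_mul_choose_two_eq (n := n)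
  rw [(Submodule.comapSubtypeEquivOfLe (siegel_le_exteriorPower K (n := n))).finrank_eq]
  generalize n * (n + 1) = N at hs hc
  omega
end Summit.Ventures.HSemireg.Wedge.HankelSiegel
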